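import Mathlib
import Literature.MathematicalPhysics.QuantumFieldTheory.Balaban1983to89.B5Substitution125

/-!
# B5 p. 22 (Sect. C): `λ₀`, `ω₀` solve (1.25), the value (1.26) of the infimum, and «I − Δ⁻¹Q′*_k
# (Q′_kΔ⁻²Q′*_k)⁻¹Q′_kΔ⁻¹ is a projection» — for the TYPED position-space operators

Source: T. Bałaban, *Propagators and renormalization transformations for lattice gauge
theories. I*, Commun. Math. Phys. 95 (1984) 17–40 (`Balaban1984PropagatorsI`, "B5"), render
`b2b-balaban-ref1/pages/1984-cmp95-propagators-rt-I/…-p006-x2.png` (PDF page 6 = journal page 22),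
read as an image.

## What the paper prints (verbatim, p. 22)

«… and the infimum in (1.24) is acquired at the function
λ₀ = Δ⁻¹∂*A − Δ⁻²Q′*_k(Q′_kΔ⁻²Q′*_k)⁻¹Q′_kΔ⁻¹∂*A.
The value of the infimum is equal to
½‖∂*A − Δλ₀‖² = ½‖Δ⁻¹Q′*_k(Q′_kΔ⁻²Q′*_k)⁻¹Q′_kΔ⁻¹∂*A‖²
             = ½⟨∂*A, Δ⁻¹Q′*_k(Q′_kΔ⁻²Q′*_k)⁻¹Q′_kΔ⁻¹∂*A⟩, (1.26)
where we have used the fact that the quadratic form in ∂* A is defined by a projection operator.»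

«It is easy to verify that the operator I − Δ⁻¹Q′*_k(Q′_kΔ⁻²Q′*_k)⁻¹Q′_kΔ⁻¹ is a projection in the
space L²(T_η) of scalar functions, so we can write also …»

## What is typed and certified here (kernel-checked, zero sorry)

With the typed operators of passes 8/19/21 — `Q′_k = QsOp n M`, `Δ = LapS (fine n M) c`,
`Δ⁻¹ = LapSinv (fine n M) c`, `(Q′_kΔ⁻²Q′*_k)⁻¹ = B5Substitution125.Minv n M c` (inverse on the
complement of constants), `c ≠ 0` (= B5's `η⁻¹`), `∂*A` = any `b ⊥ 1`:
* `PcT := Δ⁻¹Q′*_k(Q′_kΔ⁻²Q′*_k)⁻¹Q′_kΔ⁻¹` (= pass 18's abstract `Pc` at these arguments),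
  `PcT_mulVec`, `PcT_mulVec_idem`, `PcT_mul_PcT` (`PcT² = PcT`, for ALL vectors — no restriction to a
  subspace is needed), `Mop_conjTranspose`, `Cavg_conjTranspose`, `Kmat_conjTranspose`,
  `Minv_conjTranspose`, `PcT_conjTranspose` (`PcTᴴ = PcT`), `one_sub_PcT_proj` — «It is easy to
  verify that the operator I − Δ⁻¹Q′*_k(Q′_kΔ⁻²Q′*_k)⁻¹Q′_kΔ⁻¹ is a projection in the space L²(T_η)»
  VERIFIED for the typed operators on the full torus;
* `omega0`, `lambda0` (the printed `ω`, `λ₀` as typed vectors), `lambda0_eq_LapSinv`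
  (`λ₀ = Δ⁻¹(I − PcT)∂*A`), `sum_lambda0` (`λ₀ ⊥ 1`), `QsOp_lambda0` ((1.25)₂: `Q′_kλ₀ = 0`),
  `eq125_lambda0` ((1.25)₁ holds at `(λ₀, ω₀)`): together with pass 21 (`lambda0_eq`: uniqueness)
  the printed `λ₀` is THE solution of (1.25) with `λ ⊥ 1`;
* `residual_lambda0` (`∂*A − Δλ₀ = PcT ∂*A`), `value_126a`, `value_126b` — the two equalities of
  (1.26), the second «used the fact that the quadratic form in ∂* A is defined by a projection
  operator» (pass 18 `form_of_projection` with `PcT² = PcT = PcTᴴ`).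

## What is NOT certified here

That `λ₀` minimises (the infimum (1.24) itself: only criticality (1.25) is typed); (1.27)/(1.28)
(Gaussian integrals); fields complex, `η^d`-weights dropped.
-/

open scoped BigOperators Matrix ComplexConjugate ComplexOrder
open Finset Complex Matrix

namespace Literature.MathematicalPhysics.QuantumFieldTheory.Balaban1983to89.B5Value126

open Literature.MathematicalPhysics.QuantumFieldTheory.Balaban1983to89.B5Prop11Plancherel
open Literature.MathematicalPhysics.QuantumFieldTheory.Balaban1983to89.B5Action121
open Literature.MathematicalPhysics.QuantumFieldTheory.Balaban1983to89.B5Block118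
open Literature.MathematicalPhysics.QuantumFieldTheory.Balaban1983to89.B5LaplaceSpectral
open Literature.MathematicalPhysics.QuantumFieldTheory.Balaban1983to89.B5LaplaceInverse
open Literature.MathematicalPhysics.QuantumFieldTheory.Balaban1983to89.B5Projection127
open Literature.MathematicalPhysics.QuantumFieldTheory.Balaban1983to89.B5Substitution125

noncomputable section

variable {d : ℕ} (n : ℕ) [NeZero n] (M : Fin d → ℕ) [hM : ∀ μ, NeZero (M μ)] (c : ℂ)

/-! ## §1 The typed projection `Δ⁻¹Q′*_k(Q′_kΔ⁻²Q′*_k)⁻¹Q′_kΔ⁻¹` -/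

/-- `PcT := Δ⁻¹Q′*_k(Q′_kΔ⁻²Q′*_k)⁻¹Q′_kΔ⁻¹` with the typed operators (pass 18's `Pc` at
`L = Δ⁻¹`, `Q = Q′_k`, `Minv = (Q′_kΔ⁻²Q′*_k)⁻¹`). [cite: Balaban1984PropagatorsI, (1.26) p.22] -/
def PcT : Matrix (Tor (fine n M)) (Tor (fine n M)) ℂ :=
  Pc (LapSinv (fine n M) c) (QsOp n M) (Minv n M c)

/-- `PcT b = Δ⁻¹(Q′*_k((Q′_kΔ⁻²Q′*_k)⁻¹(Q′_k(Δ⁻¹b))))`. [folklore] -/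
theorem PcT_mulVec (b : Tor (fine n M) → ℂ) :
    PcT n M c *ᵥ b
      = LapSinv (fine n M) c *ᵥ ((QsOp n M)ᴴ *ᵥ (Minv n M c *ᵥ (QsOp n M *ᵥ
          (LapSinv (fine n M) c *ᵥ b)))) := by
  simp only [PcT, Pc, ← Matrix.mulVec_mulVec]

/-- `Q′_kΔ⁻¹b ⊥ 1` for every `b`. [folklore] -/
theorem sum_QsOp_LapSinv (b : Tor (fine n M) → ℂ) :
    ∑ y, (QsOp n M *ᵥ (LapSinv (fine n M) c *ᵥ b)) y = 0 := by
  rw [B5Blocks16.sum_QsOp, sum_LapSinv, mul_zero]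

/-- `(Q′_kΔ⁻²Q′*_k)⁻¹g ⊥ 1` for `g ⊥ 1` (`c ≠ 0`). [folklore] -/
theorem sum_Minv_of_orth (hc : c ≠ 0) (g : Tor M → ℂ) (hg : ∑ y, g y = 0) :
    ∑ y, (Minv n M c *ᵥ g) y = 0 := by
  have hdet := (Matrix.isUnit_iff_isUnit_det _).mp (Kmat_isUnit n M c hc)
  have hK : Kmat n M c *ᵥ (Minv n M c *ᵥ g) = g := by
    rw [Minv, Matrix.mulVec_mulVec, Matrix.mul_nonsing_inv _ hdet, Matrix.one_mulVec]
  have h := congrArg (fun f : Tor M → ℂ => ∑ y, f y) hK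
  simp only [Kmat, Matrix.add_mulVec, Pi.add_apply, Finset.sum_add_distrib, sum_Mop,
    sum_Cavg_mulVec, zero_add] at h
  rw [h, hg]

/-- `PcT(PcT b) = PcT b` for every `b` (`c ≠ 0`). [folklore] -/
theorem PcT_mulVec_idem (hc : c ≠ 0) (b : Tor (fine n M) → ℂ) :
    PcT n M c *ᵥ (PcT n M c *ᵥ b) = PcT n M c *ᵥ b := by
  rw [PcT_mulVec n M c (PcT n M c *ᵥ b), PcT_mulVec n M c b, ← Mop_mulVec,
    Mop_Minv_of_orth n M c hc _ (sum_QsOp_LapSinv n M c b)]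

omit hM in
/-- two matrices agree if they agree on every vector. [folklore] -/
theorem ext_of_mulVec {m : Type*} [Fintype m] [DecidableEq m] {A B : Matrix m m ℂ}
    (h : ∀ v, A *ᵥ v = B *ᵥ v) : A = B :=
  Matrix.toLin'.injective (LinearMap.ext fun v => by rw [Matrix.toLin'_apply, Matrix.toLin'_apply, h v])

/-- `PcT² = PcT` (`c ≠ 0`). [cite: Balaban1984PropagatorsI, (1.26) p.22] -/
theorem PcT_mul_PcT (hc : c ≠ 0) : PcT n M c * PcT n M c = PcT n M c :=
  ext_of_mulVec fun v => by rw [← Matrix.mulVec_mulVec, PcT_mulVec_idem n M c hc v]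

/-- `(Q′_kΔ⁻²Q′*_k)ᴴ = Q′_kΔ⁻²Q′*_k`. [folklore] -/
theorem Mop_conjTranspose : (Mop n M c)ᴴ = Mop n M c := by
  simp only [Mop, Matrix.conjTranspose_mul, Matrix.conjTranspose_conjTranspose,
    LapSinv_conjTranspose, ← Matrix.mul_assoc]

/-- `Cᴴ = C`. [folklore] -/
theorem Cavg_conjTranspose : (Cavg M)ᴴ = Cavg M := by
  ext i j
  simp only [Matrix.conjTranspose_apply, Cavg]
  rw [Complex.star_def, map_div₀, map_one, Complex.conj_natCast]

/-- `Kᴴ = K`. [folklore] -/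
theorem Kmat_conjTranspose : (Kmat n M c)ᴴ = Kmat n M c := by
  rw [Kmat, Matrix.conjTranspose_add, Mop_conjTranspose, Cavg_conjTranspose]

/-- `((Q′_kΔ⁻²Q′*_k)⁻¹)ᴴ = (Q′_kΔ⁻²Q′*_k)⁻¹` (typed). [folklore] -/
theorem Minv_conjTranspose : (Minv n M c)ᴴ = Minv n M c := by
  rw [Minv, Matrix.conjTranspose_nonsing_inv, Kmat_conjTranspose]

/-- `PcTᴴ = PcT`. [folklore] -/
theorem PcT_conjTranspose : (PcT n M c)ᴴ = PcT n M c := by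
  simp only [PcT, Pc, Matrix.conjTranspose_mul, Matrix.conjTranspose_conjTranspose,
    LapSinv_conjTranspose, Minv_conjTranspose, ← Matrix.mul_assoc]

/-- «It is easy to verify that the operator I − Δ⁻¹Q′*_k(Q′_kΔ⁻²Q′*_k)⁻¹Q′_kΔ⁻¹ is a projection in
the space L²(T_η) of scalar functions» — verified for the typed operators (`c ≠ 0`).
[cite: Balaban1984PropagatorsI, (1.28) p.22] -/
theorem one_sub_PcT_proj (hc : c ≠ 0) :
    (1 - PcT n M c) * (1 - PcT n M c) = 1 - PcT n M c := by
  rw [Matrix.sub_mul, Matrix.one_mul, Matrix.mul_sub, Matrix.mul_one, PcT_mul_PcT n M c hc,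
    sub_self, sub_zero]

/-! ## §2 `λ₀`, `ω₀` solve (1.25) -/

/-- the printed `ω = (Q′_kΔ⁻²Q′*_k)⁻¹Q′_kΔ⁻¹∂*A` (typed, `∂*A = b`).
[cite: Balaban1984PropagatorsI, Sect. C p.22] -/
def omega0 (b : Tor (fine n M) → ℂ) : Tor M → ℂ :=
  Minv n M c *ᵥ (QsOp n M *ᵥ (LapSinv (fine n M) c *ᵥ b))

/-- the printed `λ₀ = Δ⁻¹∂*A − Δ⁻²Q′*_k(Q′_kΔ⁻²Q′*_k)⁻¹Q′_kΔ⁻¹∂*A` (typed, `∂*A = b`).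
[cite: Balaban1984PropagatorsI, Sect. C p.22] -/
def lambda0 (b : Tor (fine n M) → ℂ) : Tor (fine n M) → ℂ :=
  LapSinv (fine n M) c *ᵥ b
    - LapSinv (fine n M) c *ᵥ (LapSinv (fine n M) c *ᵥ ((QsOp n M)ᴴ *ᵥ omega0 n M c b))

/-- `λ₀ = Δ⁻¹(I − PcT)b`. [folklore] -/
theorem lambda0_eq_LapSinv (b : Tor (fine n M) → ℂ) :
    lambda0 n M c b = LapSinv (fine n M) c *ᵥ ((1 - PcT n M c) *ᵥ b) := by
  rw [Matrix.sub_mulVec, Matrix.one_mulVec, Matrix.mulVec_sub, PcT_mulVec, lambda0, omega0]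

/-- «We assume that λ is orthogonal»: `λ₀ ⊥ 1`. [cite: Balaban1984PropagatorsI, Sect. C p.22] -/
theorem sum_lambda0 (b : Tor (fine n M) → ℂ) : ∑ x, lambda0 n M c b x = 0 := by
  rw [lambda0_eq_LapSinv, sum_LapSinv]

/-- (1.25)₂ at `λ₀`: `Q′_kλ₀ = 0` (`c ≠ 0`, every `b`). [cite: Balaban1984PropagatorsI, (1.25) p.22] -/
theorem QsOp_lambda0 (hc : c ≠ 0) (b : Tor (fine n M) → ℂ) : QsOp n M *ᵥ lambda0 n M c b = 0 := by
  rw [lambda0, omega0, Matrix.mulVec_sub, ← Mop_mulVec,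
    Mop_Minv_of_orth n M c hc _ (sum_QsOp_LapSinv n M c b), sub_self]

/-- `ΔΔ⁻¹Δ⁻¹u = Δ⁻¹u`. [folklore] -/
theorem LapS_LapSinv_LapSinv (u : Tor (fine n M) → ℂ) :
    LapS (fine n M) c *ᵥ (LapSinv (fine n M) c *ᵥ (LapSinv (fine n M) c *ᵥ u))
      = LapSinv (fine n M) c *ᵥ u := by
  simp only [Matrix.mulVec_mulVec, ← Matrix.mul_assoc]
  rw [LapS_mul_LapSinv_mul_LapSinv]

/-- `Δλ₀ = b − Δ⁻¹Q′*_kω₀` for `b ⊥ 1` (`c ≠ 0`). [folklore] -/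
theorem LapS_lambda0 (hc : c ≠ 0) (b : Tor (fine n M) → ℂ) (hb : ∑ x, b x = 0) :
    LapS (fine n M) c *ᵥ lambda0 n M c b
      = b - LapSinv (fine n M) c *ᵥ ((QsOp n M)ᴴ *ᵥ omega0 n M c b) := by
  rw [lambda0, Matrix.mulVec_sub, LapS_LapSinv_of_orth _ hc b hb, LapS_LapSinv_LapSinv]

/-- (1.25)₁ at `(λ₀, ω₀)`: `Δ²λ₀ − Δ∂*A + Q′*_kω₀ = 0` for `∂*A = b ⊥ 1` (`c ≠ 0`).
[cite: Balaban1984PropagatorsI, (1.25) p.22] -/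
theorem eq125_lambda0 (hc : c ≠ 0) (b : Tor (fine n M) → ℂ) (hb : ∑ x, b x = 0) :
    LapS (fine n M) c *ᵥ (LapS (fine n M) c *ᵥ lambda0 n M c b) - LapS (fine n M) c *ᵥ b
      + (QsOp n M)ᴴ *ᵥ omega0 n M c b = 0 := by
  have hω : ∑ y, omega0 n M c b y = 0 :=
    sum_Minv_of_orth n M c hc _ (sum_QsOp_LapSinv n M c b)
  rw [LapS_lambda0 n M c hc b hb, Matrix.mulVec_sub,
    LapS_LapSinv_of_orth _ hc _ (QsOp_adjoint_orth n M _ hω)]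
  abel

/-! ## §3 The value (1.26) -/

/-- `∂*A − Δλ₀ = Δ⁻¹Q′*_k(Q′_kΔ⁻²Q′*_k)⁻¹Q′_kΔ⁻¹∂*A` for `∂*A = b ⊥ 1` (`c ≠ 0`).
[cite: Balaban1984PropagatorsI, (1.26) p.22] -/
theorem residual_lambda0 (hc : c ≠ 0) (b : Tor (fine n M) → ℂ) (hb : ∑ x, b x = 0) :
    b - LapS (fine n M) c *ᵥ lambda0 n M c b = PcT n M c *ᵥ b := by
  rw [lambda0_eq_LapSinv, PcT]
  exact residual_eq_torus (fine n M) hc (QsOp n M) (Minv n M c) b hb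

/-- (1.26), first equality: `½‖∂*A − Δλ₀‖² = ½‖Δ⁻¹Q′*_k(Q′_kΔ⁻²Q′*_k)⁻¹Q′_kΔ⁻¹∂*A‖²`
(`∂*A = b ⊥ 1`, `c ≠ 0`). [cite: Balaban1984PropagatorsI, (1.26) p.22] -/
theorem value_126a (hc : c ≠ 0) (b : Tor (fine n M) → ℂ) (hb : ∑ x, b x = 0) :
    (1 / 2 : ℂ) * (star (b - LapS (fine n M) c *ᵥ lambda0 n M c b)
        ⬝ᵥ (b - LapS (fine n M) c *ᵥ lambda0 n M c b))
      = (1 / 2 : ℂ) * (star (PcT n M c *ᵥ b) ⬝ᵥ (PcT n M c *ᵥ b)) := by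
  rw [residual_lambda0 n M c hc b hb]

/-- (1.26), second equality: `½‖PcT ∂*A‖² = ½⟨∂*A, PcT ∂*A⟩` — «where we have used the fact that
the quadratic form in ∂* A is defined by a projection operator» (`c ≠ 0`; every `b`).
[cite: Balaban1984PropagatorsI, (1.26) p.22] -/
theorem value_126b (hc : c ≠ 0) (b : Tor (fine n M) → ℂ) :
    (1 / 2 : ℂ) * (star (PcT n M c *ᵥ b) ⬝ᵥ (PcT n M c *ᵥ b))
      = (1 / 2 : ℂ) * (star b ⬝ᵥ (PcT n M c *ᵥ b)) := by
  rw [form_of_projection (PcT n M c) (PcT_mul_PcT n M c hc) (PcT_conjTranspose n M c) b]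

end

end Literature.MathematicalPhysics.QuantumFieldTheory.Balaban1983to89.B5Value126
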